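import Summits.CriticalPhenomena.CardyFormulaZ2.Theorems.CardyBoundaryCoulombGasHalfPlaneMarkDensityLawNoFreeConstant

/-!
# Lead's skeleton (c12-0), cycle 8: **THE SELF-DUALITY CONSTRAINT ON THE JOINT SUBSEQUENTIAL LIMITS**
# (crux `HalfPlaneMarkDensityLaw`, line `Sketch`; a-priori structure beyond the lattice symmetries)

For a joint subsequential limit `G` of `P_n(a,b,c,y)` along a strictly increasing `θ` and `σ, x > 0`:
* W1 — the WIRED kernel `P_{θ n}[(−∞,−⌊σ θn⌋]×{0} ↔ [1,⌊x θn⌋]×{0} in H]` converges along `θ`, to the limit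
  `W_G(σ,x) := lim_{M→∞} G(−M, −σ, 1/M, x)` (a monotone limit of values of `G`; sandwich of `…WiredCardy` + the
  `δ`-move bound `Subseq.jointLimit_move_le` for the upper configuration `(−M, −σ+1/M, 0, x)`);
* W2 — c3-0's duality–reflection law (`SelfDual.selfDualReflection`, full sequence) then gives the constraint
  **`W_G(σ,x) + W_G(x,σ) = 1`**, in particular `lim_M G(−M,−σ,1/M,σ) = 1/2`: an exact non-linear identity satisfied
  by every joint subsequential limit, the one piece of a-priori structure that does not come from RSW and lattice
  symmetries (it is what pins the factor `m ≡ 1` in `Lines/Sketch_Proportional.lean`).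
-/

noncomputable section

namespace Summit.CriticalPhenomena.CardyFormulaZ2.Cruxes.HalfPlaneMarkDensityLaw.SketchLine

open Literature.Probability.Percolation Literature.Probability.LatticeModels
open MeasureTheory Filter Set
open scoped Topology
open Summit.CriticalPhenomena.CardyFormulaZ2.Theorems.HalfPlaneMarkDensityLaw.Negative

namespace WiredDual

/-- STUB W1: along `θ` the wired kernel converges, to `W_G(σ,x) = lim_M G(−M,−σ,1/M,x)`. [folklore] -/
theorem stub_wired_of_jointLimit :
    ∀ {θ : ℕ → ℕ} {G : ℝ → ℝ → ℝ → ℝ → ℝ},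
      (∀ a b c y : ℝ, a < b → b < c → c < y →
        Tendsto (fun n ↦ μ.real (openCrossing halfPlane (arcA a b (θ n))
          (rowIcc ⌊c * (θ n : ℕ)⌋ ⌊y * (θ n : ℕ)⌋))) atTop (𝓝 (G a b c y))) →
      StrictMono θ → ∀ σ x : ℝ, 0 < σ → 0 < x → ∃ W : ℝ,
        Tendsto (fun M : ℕ ↦ G (-(M : ℝ)) (-σ) ((M : ℝ)⁻¹) x) atTop (𝓝 W) ∧
        Tendsto (fun n ↦ μ.real (openCrossing halfPlane {v : Site 2 | v 1 = 0 ∧ v 0 ≤ -⌊σ * (θ n : ℕ)⌋} {v : Site 2 | v 1 = 0 ∧ 1 ≤ v 0 ∧ v 0 ≤ ⌊x * (θ n : ℕ)⌋})) atTop (𝓝 W) := by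
  sorry

/-- STUB W2: **`W_G(σ,x) + W_G(x,σ) = 1`** for every joint subsequential limit. [folklore] -/
theorem stub_jointLimit_selfDualConstraint :
    ∀ {θ : ℕ → ℕ} {G : ℝ → ℝ → ℝ → ℝ → ℝ},
      (∀ a b c y : ℝ, a < b → b < c → c < y →
        Tendsto (fun n ↦ μ.real (openCrossing halfPlane (arcA a b (θ n))
          (rowIcc ⌊c * (θ n : ℕ)⌋ ⌊y * (θ n : ℕ)⌋))) atTop (𝓝 (G a b c y))) →
      StrictMono θ → ∀ σ x : ℝ, 0 < σ → 0 < x → ∀ W₁ W₂ : ℝ,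
        Tendsto (fun M : ℕ ↦ G (-(M : ℝ)) (-σ) ((M : ℝ)⁻¹) x) atTop (𝓝 W₁) →
        Tendsto (fun M : ℕ ↦ G (-(M : ℝ)) (-x) ((M : ℝ)⁻¹) σ) atTop (𝓝 W₂) → W₁ + W₂ = 1 := by
  sorry

/-- STUB W2' (glue): W1 and `SelfDual.selfDualReflection` give W2. [folklore] -/
theorem stub_jointLimit_selfDualConstraint_of :
    (∀ {θ : ℕ → ℕ} {G : ℝ → ℝ → ℝ → ℝ → ℝ},
      (∀ a b c y : ℝ, a < b → b < c → c < y →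
        Tendsto (fun n ↦ μ.real (openCrossing halfPlane (arcA a b (θ n))
          (rowIcc ⌊c * (θ n : ℕ)⌋ ⌊y * (θ n : ℕ)⌋))) atTop (𝓝 (G a b c y))) →
      StrictMono θ → ∀ σ x : ℝ, 0 < σ → 0 < x → ∃ W : ℝ,
        Tendsto (fun M : ℕ ↦ G (-(M : ℝ)) (-σ) ((M : ℝ)⁻¹) x) atTop (𝓝 W) ∧
        Tendsto (fun n ↦ μ.real (openCrossing halfPlane {v : Site 2 | v 1 = 0 ∧ v 0 ≤ -⌊σ * (θ n : ℕ)⌋} {v : Site 2 | v 1 = 0 ∧ 1 ≤ v 0 ∧ v 0 ≤ ⌊x * (θ n : ℕ)⌋})) atTop (𝓝 W)) →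
    ∀ {θ : ℕ → ℕ} {G : ℝ → ℝ → ℝ → ℝ → ℝ},
      (∀ a b c y : ℝ, a < b → b < c → c < y →
        Tendsto (fun n ↦ μ.real (openCrossing halfPlane (arcA a b (θ n))
          (rowIcc ⌊c * (θ n : ℕ)⌋ ⌊y * (θ n : ℕ)⌋))) atTop (𝓝 (G a b c y))) →
      StrictMono θ → ∀ σ x : ℝ, 0 < σ → 0 < x → ∀ W₁ W₂ : ℝ,
        Tendsto (fun M : ℕ ↦ G (-(M : ℝ)) (-σ) ((M : ℝ)⁻¹) x) atTop (𝓝 W₁) →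
        Tendsto (fun M : ℕ ↦ G (-(M : ℝ)) (-x) ((M : ℝ)⁻¹) σ) atTop (𝓝 W₂) → W₁ + W₂ = 1 := by
  sorry

end WiredDual

end Summit.CriticalPhenomena.CardyFormulaZ2.Cruxes.HalfPlaneMarkDensityLaw.SketchLine
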